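import Summits.Ventures.PercRepro.ThetaOmegaBase

/-!
# Bad points, and «at most two bad points» implies the good-point property

Dossier proofs/MINE1-theoremS.md, Addendum 80 suppl. 6 (mine-1, gen 41). A point `q` of the ground
set is **bad** for a twice-coloured family when the good-point requirement of `OmegaGoodPoint`
fails at it for every valid orientation (`BadPoint`). The census (every family of 3 points, every
family with at most six members on 4 points, annealing on 5–7 points) never shows more than TWO bad
points — **Conjecture (B2)** (`OmegaAtMostTwoBad α`). Since a ground set with at least three points
then has a point that is not bad, (B2) gives the good-point property
(`omegaGoodPoint_of_atMostTwoBad`), hence (Ω) and (Σ) (`conjOmega_of_atMostTwoBad`,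
`conjSigma_of_atMostTwoBad`). Note that a point whose edge family has at least three edges, or is
not exceptional, is never bad inside the induction; the bad points are the exceptional ones whose
credit is exactly the edge family's own.
-/

namespace PercRepro.MSTight

open Finset

variable {α : Type*} [DecidableEq α]

section Bad

variable {U : Finset α} {F : Finset (Finset α)} {c0 c1 : Finset α → Bool}

/-- **The good-point requirement at `q` for an orientation `o`**: either the projection keeps at
least three members and `|π_q F| + credit ≥ |F|`, or it keeps at most two and its actual
(Ω)-count plus the credit is at least `|F|`. -/
def GoodAt (U : Finset α) (F : Finset (Finset α)) (c0 c1 : Finset α → Bool) (q : α)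
    (o : Finset α → Bool) : Prop :=
  ValidOrient q F o ∧
    ((3 ≤ (projFam q F).card ∧
        (projFam q F).card +
          ((qEdges q (omegaA F c0 c1)).card + (qEdges q (omegaC U F c1)).card) ≥ F.card) ∨
      ((projFam q F).card ≤ 2 ∧
        omegaCount (U.erase q) (projFam q F) (projColour q o c0) (projColour q o c1) +
          ((qEdges q (omegaA F c0 c1)).card + (qEdges q (omegaC U F c1)).card) ≥ F.card))

/-- **A bad point**: a point of the ground set at which the good-point requirement fails for every
orientation. -/
def BadPoint (U : Finset α) (F : Finset (Finset α)) (c0 c1 : Finset α → Bool) (q : α) : Prop :=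
  q ∈ U ∧ ∀ o : Finset α → Bool, ¬ GoodAt U F c0 c1 q o

/-- **Conjecture (B2), «at most two bad points»**: every family with at least three members has at
most two bad points (Addendum 80 suppl. 6: exhaustive on 3 points for every family, on 4 points for
`|F| ≤ 6`; annealing on 5–7 points). -/
def OmegaAtMostTwoBad (α : Type*) [DecidableEq α] : Prop :=
  ∀ (U : Finset α) (F : Finset (Finset α)) (c0 c1 : Finset α → Bool),
    (∀ s ∈ F, s ⊆ U) → 3 ≤ F.card →
      ∀ T : Finset α, (∀ q ∈ T, BadPoint U F c0 c1 q) → T.card ≤ 2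

/-- The good-point property restated with `GoodAt`. -/
theorem omegaGoodPoint_iff :
    OmegaGoodPoint α ↔ ∀ (U : Finset α) (F : Finset (Finset α)) (c0 c1 : Finset α → Bool),
      3 ≤ U.card → (∀ s ∈ F, s ⊆ U) → 3 ≤ F.card →
        ∃ q ∈ U, ∃ o : Finset α → Bool, GoodAt U F c0 c1 q o := by
  unfold OmegaGoodPoint GoodAt
  constructor
  · intro h U F c0 c1 hU hF h3
    obtain ⟨q, hq, o, ho, hg⟩ := h U F c0 c1 hU hF h3
    exact ⟨q, hq, o, ho, hg⟩
  · intro h U F c0 c1 hU hF h3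
    obtain ⟨q, hq, o, ho, hg⟩ := h U F c0 c1 hU hF h3
    exact ⟨q, hq, o, ho, hg⟩

/-- **«At most two bad points» implies the good-point property**: a ground set with at least three
points has a point that is not bad, and at it some orientation meets the requirement. -/
theorem omegaGoodPoint_of_atMostTwoBad (h : OmegaAtMostTwoBad α) : OmegaGoodPoint α := by
  rw [omegaGoodPoint_iff]
  intro U F c0 c1 hU hF h3
  by_contra hcon
  -- every point of `U` is bad
  have hbad : ∀ q ∈ U, BadPoint U F c0 c1 q := by
    intro q hq
    refine ⟨hq, fun o hgo => ?_⟩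
    exact hcon ⟨q, hq, o, hgo⟩
  have := h U F c0 c1 hF h3 U hbad
  omega

/-- **(Ω) from «at most two bad points».** -/
theorem conjOmega_of_atMostTwoBad (h : OmegaAtMostTwoBad α) : ConjOmega α :=
  conjOmega_of_goodPoint (omegaGoodPoint_of_atMostTwoBad h)

/-- **(Σ) from «at most two bad points».** -/
theorem conjSigma_of_atMostTwoBad [Fintype α] (h : OmegaAtMostTwoBad α) : ConjSigma α :=
  conjSigma_of_conjOmega (conjOmega_of_atMostTwoBad h)

end Bad

end PercRepro.MSTight
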